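import Summits.HubbardSuperconductivity.HubbardLadder.Bounds.StiffnessCeilingTPrime
import Summits.HubbardSuperconductivity.HubbardLadder.Bounds.StiffnessCeilingsProofs
import Literature.MathematicalPhysics.QuantumLattice.HubbardTorusRepulsionGap
import Literature.MathematicalPhysics.QuantumLattice.HubbardDoubleOccupancyBounds
import Literature.MathematicalPhysics.QuantumLattice.HubbardLangerMattisMoments
import HarnessLib

/-!
# Hubbard ladder — Bounds: kinetic-energy and stiffness ceilings from certified ENERGY BRACKETS
# (the concavity/chord hook of bounds.tex Thm 3, typed AND proved)

HONEST FRAMING (cell pub-hubbard): ladder R1–R4 with certified numbers; no claim on H/H₀. These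
are bounds for MODEL CLASSES (the square-lattice Hubbard torus `hubbardTorus 2 L 1 U`, resp. the
`t–t'` torus `hubbardTorusTT' L 1 t' U`, every filling, every `U ≥ 0`); no materials claim.
Companion text: `pub-hubbard/paper/bounds.tex` §3 (Thm 3 = SHARPENING #2, "the hook from the R1
energy table to a certified stiffness / T_c ceiling"); tables `pub-hubbard/pub-hubbard-bounds/BOUNDS.md`
(row T3) and `EXTREMISERS.md` §5a (the certified column this file justifies).

FILE SPLIT (tree lint: files under `Summits/…` are ≤ 400 lines): this is part 1 of 3 of the bounds
seat's `StiffnessFromEnergyBrackets` (v2, 734 lines) — the `t' = 0` finite torus; part 2 =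
`StiffnessFromEnergyBracketsTPrime.lean` (the `t–t'` class, finite torus), part 3 =
`StiffnessFromEnergyBracketsTL.lean` (thermodynamic limit, both classes). Statements unchanged.

## What is proved (no `sorry`, no new axioms)

Write `E(U) = sectorEnergy L U N M = minEnergyOn (hubbardTorus 2 L 1 U) (szSector N M)`,
`D(ψ) = Re⟨ψ, Σ_x n_{x↑}n_{x↓} ψ⟩` (`doubleOccExp`), `K_x, K_y` the bond kinetic weights
(`kinWeightDir 0/1`, one orientation per bond, both spins), so that `⟨-T⟩_ψ = 2(K_x + K_y)(ψ)`.

* `sectorEnergy_le_add_mul_doubleOccExp` — **chord (supergradient) inequality in every joint sector**: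
  for a unit ground state `ψ` of `H(1,U)` in `(N, S^z = M)` and every `U'`,
  `E(U') ≤ E(U) + (U' - U) D(ψ)` (Koma–Tasaki 1994 §1; the tree's `DoubleOccupancy` file has the
  `N`-sector version, this is the `(N, S^z)`-sector one the flux stiffness needs).
* `KineticBracketFromEnergyBrackets` (`@[conjecture] def`, PROVED by `…_holds` from
  `two_mul_kinWeight_le_of_energyBrackets` / `…_ge_…`) — **two-sided kinetic bracket for EVERY ground
  state from energy brackets** (bounds.tex Thm 3(i)): with `U ≥ 0`, `U₁ < U < U₂`,
  `Em ≤ E(U) ≤ R`, `L₁ ≤ E(U₁)`, `L₂ ≤ E(U₂)`: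
  `U (L₂ - R)/(U₂ - U) - R ≤ ⟨-T⟩_ψ ≤ U (R - L₁)/(U - U₁) - Em`.
* `StiffnessCeilingFromEnergyBrackets` (`@[conjecture] def`, PROVED by `…_holds`) — **certified-bracket
  stiffness ceiling** (Thm 3(i) ∘ Thm 1(c)): for `L ≥ 3`, `δ ≥ -1`, `0 ≤ U`, `U₁ < U`, every flux
  stiffness `ρ_s` of the `(N_L, S^z = 0)` sector (`ρ_s θ² ≤ E_L(θ) - E_L(0)`, `|θ| ≤ θ₀`) obeys
  `ρ_s L² ≤ (U (R - L₁)/(U - U₁) - Em) / 4` for all brackets `Em ≤ E_L(U;0) ≤ R`, `L₁ ≤ E_L(U₁;0)`.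
  Proof: f-sum floor on `ψ` AND on the rotated ground state `Γ(r)ψ` (`K_y(Γψ) = K_x(ψ)`), summed:
  `2 ρ_s L² ≤ (K_x + K_y)(Γψ) ≤ bracket/2`.

References (keys of `lean/references.bib`): KomaTasaki1994 §1 (supergradient); HazraVermaRanderia2019
eqs. (2)–(6) and App. G; ParamekantiTrivediRanderia1998 eq. (3); ScalapinoWhiteZhang1993 §II;
LangerMattis1971 eqs. (3)–(5); LiebPRL1989 (sector reduction `E(2n) = E(2n, S^z = 0)`).
-/

noncomputable section

namespace Summit.HubbardSuperconductivity.HubbardLadder.Bounds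

open Matrix Finset Real Filter Topology
open Literature.MathematicalPhysics.QuantumLattice
open Literature.MathematicalPhysics.QuantumFieldTheory
open Literature.Probability.LatticeModels
open Literature.MathematicalPhysics.QuantumLattice.LangerMattis
open Literature.MathematicalPhysics.QuantumLattice.ThermodynamicLimit
open scoped ComplexOrder ComplexConjugate Topology

variable {L : ℕ} [NeZero L]

/-! ### Objects -/

/-- The double-occupancy expectation `D(ψ) = Re⟨ψ, Σ_x n_{x↑} n_{x↓} ψ⟩`. -/
def doubleOccExp (ψ : Fock (Orb (FermionTorus 2 L))) : ℝ :=
  (star ψ ⬝ᵥ ((∑ x : FermionTorus 2 L, numberOp x 0 * numberOp x 1) *ᵥ ψ)).re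

/-- The sector energy `E_L(U; N, M) = minEnergyOn (hubbardTorus 2 L 1 U) (szSector N M)` (`t = 1`). -/
def sectorEnergy (L : ℕ) [NeZero L] (U : ℝ) (N : ℕ) (M : ℝ) : ℝ :=
  (hubbardTorus 2 L 1 U).minEnergyOn (szSector (Λ := FermionTorus 2 L) N M)

/-- The zero-flux envelope is the `(N_L, S^z = 0)` sector energy. -/
theorem fluxEnergy_zero_eq_sectorEnergy (U δ : ℝ) :
    fluxEnergy L U δ 0 = sectorEnergy L U (2 * ⌊(1 - δ) * (L : ℝ) ^ 2 / 2⌋₊) 0 := by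
  rw [fluxEnergy_eq, hubbardTorusFlux_zero]
  rfl
/-! ### Energy identities -/

/-- `Re⟨ψ, H(1,0) ψ⟩ = -2 (K_x + K_y)(ψ)` on the `L × L` torus, `L ≥ 3`. -/
theorem re_expect_hubbardTorus_zero_eq_kin (hL : 3 ≤ L) (ψ : Fock (Orb (FermionTorus 2 L))) :
    (star ψ ⬝ᵥ (hubbardTorus 2 L 1 0 *ᵥ ψ)).re = -(2 * (kinWeightDir 0 ψ + kinWeightDir 1 ψ)) := by
  rw [← sum_re_hopOp_eq hL ψ, hubbardTorus, hamiltonian_eq_add_speciesHamiltonian]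
  simp only [speciesHamiltonian, zero_div, Complex.ofReal_zero, zero_smul, add_zero,
    Complex.ofReal_one, neg_smul, one_smul, Matrix.add_mulVec, Matrix.neg_mulVec, dotProduct_add,
    dotProduct_neg, Complex.add_re, Complex.neg_re, Fin.sum_univ_two]
  ring

/-- `Re⟨ψ, H(1,U) ψ⟩ = -2 (K_x + K_y)(ψ) + U D(ψ)` (`L ≥ 3`). -/
theorem re_expect_hubbardTorus_eq_kin (hL : 3 ≤ L) (U : ℝ) (ψ : Fock (Orb (FermionTorus 2 L))) :
    (star ψ ⬝ᵥ (hubbardTorus 2 L 1 U *ᵥ ψ)).re =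
      -(2 * (kinWeightDir 0 ψ + kinWeightDir 1 ψ)) + U * doubleOccExp ψ := by
  rw [re_expect_hubbardTorus_eq U ψ, re_expect_hubbardTorus_zero_eq_kin hL]
  rfl

/-- The energy of a unit sector ground state is the sector energy. -/
theorem re_expect_eq_sectorEnergy {U : ℝ} {N : ℕ} {M : ℝ} {ψ : Fock (Orb (FermionTorus 2 L))}
    (hgs : IsGroundStateInSector (hubbardTorus 2 L 1 U) N M ψ) (h1 : star ψ ⬝ᵥ ψ = 1) :
    (star ψ ⬝ᵥ (hubbardTorus 2 L 1 U *ᵥ ψ)).re = sectorEnergy L U N M := by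
  rw [hgs.2.2, dotProduct_smul, h1, smul_eq_mul, mul_one, Complex.ofReal_re, sectorEnergy]

/-! ### The chord (supergradient) inequality in a joint sector -/

/-- **Chord inequality** (Koma–Tasaki 1994 §1, joint-sector version): for a unit ground state `ψ` of
`H(1,U)` in the sector `(N, S^z = M)` and every `U'`, `E(U') ≤ E(U) + (U' - U) D(ψ)` — `ψ` is a trial
state for `H(1,U') = H(1,U) + (U' - U) Σ_x n_{x↑}n_{x↓}` in the same sector. -/
theorem sectorEnergy_le_add_mul_doubleOccExp {U : ℝ} {N : ℕ} {M : ℝ}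
    {ψ : Fock (Orb (FermionTorus 2 L))} (hgs : IsGroundStateInSector (hubbardTorus 2 L 1 U) N M ψ)
    (h1 : star ψ ⬝ᵥ ψ = 1) (U' : ℝ) :
    sectorEnergy L U' N M ≤ sectorEnergy L U N M + (U' - U) * doubleOccExp ψ := by
  have h := minEnergyOn_le_rayleigh_of_mem (H := hubbardTorus 2 L 1 U')
    (LiebThm1.hamiltonian_isHermitian (fermionTorusGraph 2 L) 1 U') _ hgs.1 h1
  rw [re_expect_hubbardTorus_eq U' ψ] at h
  have hU := re_expect_hubbardTorus_eq U ψ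
  rw [re_expect_eq_sectorEnergy hgs h1] at hU
  have hD : (star ψ ⬝ᵥ ((∑ x : FermionTorus 2 L, numberOp x 0 * numberOp x 1) *ᵥ ψ)).re =
      doubleOccExp ψ := rfl
  rw [hD] at h hU
  change (hubbardTorus 2 L 1 U').minEnergyOn (szSector N M) ≤ _
  nlinarith [h, hU]

/-! ### Two-sided kinetic brackets for every ground state (bounds.tex Thm 3(i)) -/

/-- **Upper kinetic bracket.** `U ≥ 0`, `U₁ < U`, `Em ≤ E(U) ≤ R`, `L₁ ≤ E(U₁)`: every unit ground
state `ψ` of the sector has `⟨-T⟩_ψ = 2(K_x + K_y)(ψ) ≤ U (R - L₁)/(U - U₁) - Em`. -/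
theorem two_mul_kinWeight_le_of_energyBrackets (hL : 3 ≤ L) {U U₁ : ℝ} (hU : 0 ≤ U) (hU₁ : U₁ < U)
    {N : ℕ} {M : ℝ} {ψ : Fock (Orb (FermionTorus 2 L))}
    (hgs : IsGroundStateInSector (hubbardTorus 2 L 1 U) N M ψ) (h1 : star ψ ⬝ᵥ ψ = 1)
    {Em R L₁ : ℝ} (hEm : Em ≤ sectorEnergy L U N M) (hR : sectorEnergy L U N M ≤ R)
    (hL₁ : L₁ ≤ sectorEnergy L U₁ N M) :
    2 * (kinWeightDir 0 ψ + kinWeightDir 1 ψ) ≤ U * ((R - L₁) / (U - U₁)) - Em := by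
  have hkin : 2 * (kinWeightDir 0 ψ + kinWeightDir 1 ψ) =
      U * doubleOccExp ψ - sectorEnergy L U N M := by
    have h := re_expect_hubbardTorus_eq_kin hL U ψ
    rw [re_expect_eq_sectorEnergy hgs h1] at h
    linarith
  have hch := sectorEnergy_le_add_mul_doubleOccExp hgs h1 U₁
  have hd : 0 < U - U₁ := sub_pos.2 hU₁
  have hD : doubleOccExp ψ ≤ (R - L₁) / (U - U₁) := by
    rw [le_div_iff₀ hd]
    nlinarith [hch, hR, hL₁]
  have hUD := mul_le_mul_of_nonneg_left hD hU
  linarith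

/-- **Lower kinetic bracket.** `U ≥ 0`, `U < U₂`, `E(U) ≤ R`, `L₂ ≤ E(U₂)`: every unit ground state
`ψ` of the sector has `U (L₂ - R)/(U₂ - U) - R ≤ ⟨-T⟩_ψ = 2(K_x + K_y)(ψ)`. -/
theorem two_mul_kinWeight_ge_of_energyBrackets (hL : 3 ≤ L) {U U₂ : ℝ} (hU : 0 ≤ U) (hU₂ : U < U₂)
    {N : ℕ} {M : ℝ} {ψ : Fock (Orb (FermionTorus 2 L))}
    (hgs : IsGroundStateInSector (hubbardTorus 2 L 1 U) N M ψ) (h1 : star ψ ⬝ᵥ ψ = 1)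
    {R L₂ : ℝ} (hR : sectorEnergy L U N M ≤ R) (hL₂ : L₂ ≤ sectorEnergy L U₂ N M) :
    U * ((L₂ - R) / (U₂ - U)) - R ≤ 2 * (kinWeightDir 0 ψ + kinWeightDir 1 ψ) := by
  have hkin : 2 * (kinWeightDir 0 ψ + kinWeightDir 1 ψ) =
      U * doubleOccExp ψ - sectorEnergy L U N M := by
    have h := re_expect_hubbardTorus_eq_kin hL U ψ
    rw [re_expect_eq_sectorEnergy hgs h1] at h
    linarith
  have hch := sectorEnergy_le_add_mul_doubleOccExp hgs h1 U₂
  have hd : 0 < U₂ - U := sub_pos.2 hU₂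
  have hD : (L₂ - R) / (U₂ - U) ≤ doubleOccExp ψ := by
    rw [div_le_iff₀ hd]
    nlinarith [hch, hR, hL₂]
  have hUD := mul_le_mul_of_nonneg_left hD hU
  linarith

/-- **Two-sided kinetic bracket from energy brackets (bounds.tex Thm 3(i); PROVED below).** On the
`L × L` torus (`L ≥ 3`, `t = 1`), for `0 ≤ U`, `U₁ < U < U₂` and EVERY unit ground state `ψ` of
`H(1,U)` in a joint sector `(N, S^z = M)`: brackets `Em ≤ E(U) ≤ R`, `L₁ ≤ E(U₁)`, `L₂ ≤ E(U₂)` of the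
sector energies give
`U (L₂ - R)/(U₂ - U) - R ≤ ⟨-T⟩_ψ = 2(K_x + K_y)(ψ) ≤ U (R - L₁)/(U - U₁) - Em`
(`⟨-T⟩ = U D - E` and the chord bounds `(L₂ - R)/(U₂ - U) ≤ D(ψ) ≤ (R - L₁)/(U - U₁)`). -/
@[conjecture] def KineticBracketFromEnergyBrackets : Prop :=
  ∀ (L : ℕ) [NeZero L], 3 ≤ L → ∀ (U U₁ U₂ : ℝ) (N : ℕ) (M : ℝ), 0 ≤ U → U₁ < U → U < U₂ →
    ∀ ψ : Fock (Orb (FermionTorus 2 L)), IsGroundStateInSector (hubbardTorus 2 L 1 U) N M ψ →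
      star ψ ⬝ᵥ ψ = 1 → ∀ (Em R L₁ L₂ : ℝ), Em ≤ sectorEnergy L U N M → sectorEnergy L U N M ≤ R →
        L₁ ≤ sectorEnergy L U₁ N M → L₂ ≤ sectorEnergy L U₂ N M →
        U * ((L₂ - R) / (U₂ - U)) - R ≤ 2 * (kinWeightDir 0 ψ + kinWeightDir 1 ψ) ∧
          2 * (kinWeightDir 0 ψ + kinWeightDir 1 ψ) ≤ U * ((R - L₁) / (U - U₁)) - Em

/-- **Proof of `KineticBracketFromEnergyBrackets`.** -/
theorem kineticBracketFromEnergyBrackets_holds : KineticBracketFromEnergyBrackets := by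
  intro L _ hL U U₁ U₂ N M hU hU₁ hU₂ ψ hgs h1 Em R L₁ L₂ hEm hR hL₁ hL₂
  exact ⟨two_mul_kinWeight_ge_of_energyBrackets hL hU hU₂ hgs h1 hR hL₂,
    two_mul_kinWeight_le_of_energyBrackets hL hU hU₁ hgs h1 hEm hR hL₁⟩

/-! ### The certified-bracket stiffness ceiling (bounds.tex Thm 3(i) ∘ Thm 1(c)) -/

/-- **Certified-bracket stiffness ceiling, nearest-neighbour class (PROVED below).** For `L ≥ 3`,
`δ ≥ -1`, `U ≥ 0`, `U₁ < U`: if `ρ_s > 0` is a flux stiffness of the `(N_L, S^z = 0)` sector of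
`hubbardTorus 2 L 1 U` (`ρ_s θ² ≤ E_L(θ) - E_L(0)` for `|θ| ≤ θ₀`, `E_L(θ) = fluxEnergy L U δ θ`), then
for ALL numbers `Em ≤ E_L(U; 0) ≤ R` and `L₁ ≤ E_L(U₁; 0)` (certified energy brackets at the two
couplings, same torus, same filling):
`ρ_s L² ≤ (U (R - L₁)/(U - U₁) - Em) / 4`.
In the notation of bounds.tex: `ρ_s ≤ 𝒦/8` with `𝒦 = ⟨-T⟩/L²` the kinetic energy per site, and
`𝒦 ≤ U (R - L₁)/((U - U₁)L²) - Em/L²` by concavity of `U ↦ E(U)`. -/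
@[conjecture] def StiffnessCeilingFromEnergyBrackets : Prop :=
  ∀ (L : ℕ) [NeZero L], 3 ≤ L → ∀ (U U₁ δ ρs θ₀ : ℝ), -1 ≤ δ → 0 ≤ U → U₁ < U → 0 < ρs → 0 < θ₀ →
    (∀ θ : ℝ, |θ| ≤ θ₀ → ρs * θ ^ 2 ≤ fluxEnergy L U δ θ - fluxEnergy L U δ 0) →
    ∀ (Em R L₁ : ℝ), Em ≤ fluxEnergy L U δ 0 → fluxEnergy L U δ 0 ≤ R → L₁ ≤ fluxEnergy L U₁ δ 0 →
      ρs * (L : ℝ) ^ 2 ≤ (U * ((R - L₁) / (U - U₁)) - Em) / 4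

/-- **Proof of `StiffnessCeilingFromEnergyBrackets`**: f-sum floor on a unit ground state `ψ` and on
`Γ(r)ψ`, `K_y(Γ(r)ψ) = K_x(ψ)`, and the upper kinetic bracket for `Γ(r)ψ`. -/
theorem stiffnessCeilingFromEnergyBrackets_holds : StiffnessCeilingFromEnergyBrackets := by
  intro L _ hL U U₁ δ ρs θ₀ hδ hU hU₁ hρs hθ₀ hst Em R L₁ hEm hR hL₁
  obtain ⟨ψ, h1, hgs⟩ := NoGo.exists_unit_groundStateInSector_hubbardTorus L 1 U
    (NoGo.floor_pairNumber_le δ hδ L)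
  set φ : Fock (Orb (FermionTorus 2 L)) :=
    fockMapOp (d4Orb (DihedralGroup.r 1 : DihedralGroup 4)) *ᵥ ψ with hφ_def
  have hφgs : IsGroundStateInSector (hubbardTorus 2 L 1 U) (2 * ⌊(1 - δ) * (L : ℝ) ^ 2 / 2⌋₊) 0 φ :=
    hgs.fockMapOp_d4Orb_mulVec _
  have hφ1 : star φ ⬝ᵥ φ = 1 := by
    rw [hφ_def, star_fockMapOp_mulVec_dotProduct_self _ (d4Orb_bijective _).injective, h1]
  have hKy : kinWeightDir 1 φ = kinWeightDir 0 ψ := kinWeightDir_one_rot ψ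
  have hfψ : ρs * (L : ℝ) ^ 2 ≤ kinWeightDir 0 ψ :=
    (stiffness_mul_sq_le_sum_re_hop_of_isGroundStateInSector hL U δ hρs hθ₀ hst hgs h1).trans_eq
      (kinWeightX_eq_kinWeightDir ψ)
  have hfφ : ρs * (L : ℝ) ^ 2 ≤ kinWeightDir 0 φ :=
    (stiffness_mul_sq_le_sum_re_hop_of_isGroundStateInSector hL U δ hρs hθ₀ hst hφgs hφ1).trans_eq
      (kinWeightX_eq_kinWeightDir φ)
  rw [fluxEnergy_zero_eq_sectorEnergy (L := L) U δ] at hEm hR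
  rw [fluxEnergy_zero_eq_sectorEnergy (L := L) U₁ δ] at hL₁
  have hb := two_mul_kinWeight_le_of_energyBrackets hL hU hU₁ hφgs hφ1 hEm hR hL₁
  rw [hKy] at hb
  linarith

end Summit.HubbardSuperconductivity.HubbardLadder.Bounds

end
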